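import Mathlib
import Summits.MatrixMultiplication.MatrixMultiplication.Theses.ProbeRankThreshold

/-!
# Route ProbeRankThreshold — typed decomposition of the deciding crux `ScaleDeficit`

`ScaleDeficit` (stmt-MatrixMultiplication-6600; a polynomial deficit `n^{θδ}` against every
decomposition of `⟨n,n,n⟩` whose probes have rank `≤ n^θ`, for one scale `θ ≤ 1/2`) is derived
from three pieces, none of which is a lower bound for a class of decompositions containing the
recursive designs (so none is "false if `ω = 2`" by a known argument):

* `BoundedBlockExhaustion` (X₁, new crux): at some scale `θ ∈ (0,1/2]`, DESIGNS WITH BOUNDED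
  BLOCKS are asymptotically optimal — every decomposition of `⟨n,n,n⟩` with probes of rank `≤ n^θ`
  and `r ≤ n^σ` terms is matched, for every `ε > 0` and all large `n`, by a decomposition of a
  direct sum `s⊙⟨m,m,m⟩` (`2 ≤ m ≤ b`, any number of copies `s`, rank-sums `≤ p` on all three
  legs) whose power-invariant exponents are at least as good: `p³ ≤ V^θ` (scale `≤ θ`) and
  `r₀³ ≤ V^{σ+ε}` (cost exponent `≤ σ + ε`), `V = s·m³`;
* `StrictXRankLaw` (X₂, the route's crux stmt-MatrixMultiplication-6601): no design is flat-tight,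
  `s·m³ < r₀·p`;
* `AmortizedBlockStrictness` (X₃, new crux): with bounded blocks the strictness is uniform in the
  number of copies and in the rank-sum budget: `s·m³ ≤ r₀·p^{1−γ(b)}` once `s ≥ S₀(b)`.

Assembly (`scaleDeficit_of_subs`): take `θ, b` from X₁ and `γ, S₀` from X₃;
a too-efficient decomposition at scale `θ` (exponent `σ = 3 − θ + θδ`) is matched by a bounded-block
design; if it has `s ≥ S₀` copies, X₃ gives `V³ ≤ r₀³ (p³)^{1−γ} ≤ V^{σ+ε+θ(1−γ)}`, i.e.
`θγ ≤ θδ + ε` — false for `δ = γ/2`, `ε = θγ/4`; if it has `s < S₀` copies its volume is bounded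
(`V ≤ S₀ b³`), its effective rank-sum budget is `p' = min(p, s·m)`, and the INTEGRALITY GAP of X₂
(`V + 1 ≤ r₀ p'`) gives `(V+1)³ ≤ V^{3+θδ+ε} ≤ V³ · V₁^{x₁} = V³ (1 + 1/(2V₁))` with
`V₁ = S₀ b³ + 8`, `x₁ = log_{V₁}(1 + 1/(2V₁))`, contradicting `(V+1)³ ≥ V³ + 3V²`.
-/

namespace Summit.MatrixMultiplication.MatrixMultiplication.Theorems

open scoped BigOperators
open Literature.Computability.AlgebraicComplexity
open Summit.MatrixMultiplication.MatrixMultiplication.Theses.ProbeRankThreshold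

/-- The rank-sum over the `s` copies of a leg of a design for `s⊙⟨m,m,m⟩` is at most `s·m`
(each block is an `m × m` matrix). [folklore] -/
theorem scaleDeficitSplit_rankSum_le (s m : ℕ) (f : Fin s × (Fin m × Fin m) → ℂ) :
    ∑ c : Fin s, (Matrix.of fun p' q => f (c, (p', q))).rank ≤ s * m := by
  calc ∑ c : Fin s, (Matrix.of fun p' q => f (c, (p', q))).rank
      ≤ ∑ _c : Fin s, m := Finset.sum_le_sum fun c _ => Matrix.rank_le_width _
    _ = s * m := by simp

/-- **Typed decomposition of `ScaleDeficit`** (BC2 redirect of the deciding crux of route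
`ProbeRankThreshold`): bounded-block exhaustion (X₁) + exact strictness of the direct-sum X-rank
law (X₂ = `StrictXRankLaw`) + amortized strictness at bounded block size (X₃) imply
`ScaleDeficit`. See the module docstring for the argument. [folklore] -/
theorem scaleDeficit_of_subs
    (hE : ∃ θ : ℝ, 0 < θ ∧ θ ≤ 1 / 2 ∧ ∃ b : ℕ, ∀ ε : ℝ, 0 < ε → ∃ n₁ : ℕ, ∀ n : ℕ, n₁ ≤ n →
      ∀ (r : ℕ) (w u v : Fin r → Fin n × Fin n → ℂ),
        matMulTensor ℂ n n n = ∑ i, triad (w i) (u i) (v i) →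
        (∀ i, ((Matrix.of fun p q => w i (p, q)).rank : ℝ) ≤ (n : ℝ) ^ θ ∧
          ((Matrix.of fun p q => u i (p, q)).rank : ℝ) ≤ (n : ℝ) ^ θ ∧
          ((Matrix.of fun p q => v i (p, q)).rank : ℝ) ≤ (n : ℝ) ^ θ) →
        ∀ σ : ℝ, (r : ℝ) ≤ (n : ℝ) ^ σ →
          ∃ (s m p r₀ : ℕ), 1 ≤ s ∧ 2 ≤ m ∧ m ≤ b ∧ 2 ≤ p ∧
            (p : ℝ) ^ 3 ≤ ((s * m ^ 3 : ℕ) : ℝ) ^ θ ∧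
            (r₀ : ℝ) ^ 3 ≤ ((s * m ^ 3 : ℕ) : ℝ) ^ (σ + ε) ∧
            ∃ (w₀ u₀ v₀ : Fin r₀ → Fin s × (Fin m × Fin m) → ℂ),
              kroneckerTensor (unitTensor ℂ s) (matMulTensor ℂ m m m) =
                ∑ i, triad (w₀ i) (u₀ i) (v₀ i) ∧
              ∀ i, ∑ c : Fin s, (Matrix.of fun p' q => w₀ i (c, (p', q))).rank ≤ p ∧
                ∑ c : Fin s, (Matrix.of fun p' q => u₀ i (c, (p', q))).rank ≤ p ∧
                ∑ c : Fin s, (Matrix.of fun p' q => v₀ i (c, (p', q))).rank ≤ p)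
    (hS : StrictXRankLaw)
    (hA : ∀ b : ℕ, ∃ γ : ℝ, 0 < γ ∧ ∃ S₀ : ℕ, ∀ (s m p r : ℕ), S₀ ≤ s → 1 ≤ m → m ≤ b → 2 ≤ p →
      ∀ (w u v : Fin r → Fin s × (Fin m × Fin m) → ℂ),
        kroneckerTensor (unitTensor ℂ s) (matMulTensor ℂ m m m) = ∑ i, triad (w i) (u i) (v i) →
        (∀ i, ∑ c : Fin s, (Matrix.of fun p' q => w i (c, (p', q))).rank ≤ p ∧
          ∑ c : Fin s, (Matrix.of fun p' q => u i (c, (p', q))).rank ≤ p ∧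
          ∑ c : Fin s, (Matrix.of fun p' q => v i (c, (p', q))).rank ≤ p) →
        ((s * m ^ 3 : ℕ) : ℝ) ≤ (r : ℝ) * (p : ℝ) ^ (1 - γ)) :
    ScaleDeficit := by
  obtain ⟨θ, hθ, hθ2, b, hX⟩ := hE
  obtain ⟨γ, hγ, S₀, hAm⟩ := hA b
  -- WLOG `γ ≤ 1/2`
  set γ' : ℝ := min γ (1 / 2) with hγ'def
  have hγ'pos : 0 < γ' := lt_min hγ (by norm_num)
  have hγ'le : γ' ≤ γ := min_le_left _ _
  have hγ'half : γ' ≤ 1 / 2 := min_le_right _ _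
  -- the volume bound of the small-copy regime and its exponent gain
  set V₁ : ℝ := (S₀ : ℝ) * (b : ℝ) ^ 3 + 8 with hV₁def
  have hV₁8 : (8 : ℝ) ≤ V₁ := by
    have : (0 : ℝ) ≤ (S₀ : ℝ) * (b : ℝ) ^ 3 := by positivity
    linarith
  have hV₁pos : (0 : ℝ) < V₁ := by linarith
  have hV₁one : (1 : ℝ) < V₁ := by linarith
  set x₁ : ℝ := Real.logb V₁ (1 + 1 / (2 * V₁)) with hx₁def
  have harg : (1 : ℝ) < 1 + 1 / (2 * V₁) := by
    have : (0 : ℝ) < 1 / (2 * V₁) := by positivity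
    linarith
  have hx₁ : 0 < x₁ := Real.logb_pos hV₁one harg
  have hV₁x : V₁ ^ x₁ = 1 + 1 / (2 * V₁) :=
    Real.rpow_logb hV₁pos hV₁one.ne' (by linarith)
  -- the gain `δ` and the slack `ε`
  set δ : ℝ := min (x₁ / 2) (γ' / 2) with hδdef
  have hδpos : 0 < δ := lt_min (by linarith) (by linarith)
  have hδx : δ ≤ x₁ / 2 := min_le_left _ _
  have hδγ : δ ≤ γ' / 2 := min_le_right _ _
  have hθγ : 0 < θ * γ' := mul_pos hθ hγ'pos
  set ε : ℝ := min (x₁ / 4) (θ * γ' / 4) with hεdef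
  have hεpos : 0 < ε := lt_min (by linarith) (by linarith)
  have hεx : ε ≤ x₁ / 4 := min_le_left _ _
  have hεγ : ε ≤ θ * γ' / 4 := min_le_right _ _
  have hθδ : θ * δ ≤ δ / 2 := by
    have := mul_le_mul_of_nonneg_right hθ2 hδpos.le
    linarith
  have hθδ' : θ * δ ≤ θ * γ' / 2 := by
    have := mul_le_mul_of_nonneg_left hδγ hθ.le
    linarith [this, show θ * (γ' / 2) = θ * γ' / 2 by ring]
  refine ⟨θ, hθ, hθ2, δ, hδpos, ?_⟩
  intro n₀
  obtain ⟨n₁, hn₁⟩ := hX ε hεpos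
  refine ⟨max n₀ n₁, le_max_left _ _, ?_⟩
  intro r w u v hdec hprobe
  by_contra hlt
  push Not at hlt
  -- the exponent `σ` of the too-efficient decomposition
  set σ : ℝ := 3 - θ * (1 - δ) with hσdef
  obtain ⟨s, m, p, r₀, hs, hm, hmb, hp, hscale, hcost, w₀, u₀, v₀, hdec₀, hrk₀⟩ :=
    hn₁ (max n₀ n₁) (le_max_right _ _) r w u v hdec hprobe σ hlt.le
  -- the volume `V = s·m³ ≥ 8`
  set V : ℕ := s * m ^ 3 with hVdef
  have hm3 : 8 ≤ m ^ 3 := by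
    calc 8 = 2 ^ 3 := by norm_num
      _ ≤ m ^ 3 := Nat.pow_le_pow_left hm 3
  have hV8 : 8 ≤ V := by
    calc 8 = 1 * 8 := by norm_num
      _ ≤ s * m ^ 3 := Nat.mul_le_mul hs hm3
  have hV8R : (8 : ℝ) ≤ (V : ℝ) := by exact_mod_cast hV8
  have hVpos : (0 : ℝ) < (V : ℝ) := by linarith
  have hVone : (1 : ℝ) < (V : ℝ) := by linarith
  have hp0 : (0 : ℝ) ≤ (p : ℝ) := Nat.cast_nonneg _
  have hp1 : (1 : ℝ) ≤ (p : ℝ) := by exact_mod_cast (le_trans (by norm_num) hp)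
  have hr0 : (0 : ℝ) ≤ (r₀ : ℝ) := Nat.cast_nonneg _
  -- `V³` as a real power
  have hV3 : (V : ℝ) ^ (3 : ℝ) = (V : ℝ) ^ (3 : ℕ) := by
    exact_mod_cast Real.rpow_natCast (V : ℝ) 3
  rcases Nat.lt_or_ge s S₀ with hsS | hsS
  · -- SMALL-COPY REGIME (`s < S₀`): exact strictness (X₂) + integrality + bounded volume
    set p' : ℕ := min p (s * m) with hp'def
    have hsm : 2 ≤ s * m := by
      calc 2 = 1 * 2 := by norm_num
        _ ≤ s * m := Nat.mul_le_mul hs hm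
    have hp' : 2 ≤ p' := le_min hp hsm
    have hrk' : ∀ i, ∑ c : Fin s, (Matrix.of fun p' q => w₀ i (c, (p', q))).rank ≤ p' ∧
        ∑ c : Fin s, (Matrix.of fun p' q => u₀ i (c, (p', q))).rank ≤ p' ∧
        ∑ c : Fin s, (Matrix.of fun p' q => v₀ i (c, (p', q))).rank ≤ p' := by
      intro i
      obtain ⟨h1, h2, h3⟩ := hrk₀ i
      exact ⟨le_min h1 (scaleDeficitSplit_rankSum_le s m (w₀ i)),
        le_min h2 (scaleDeficitSplit_rankSum_le s m (u₀ i)),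
        le_min h3 (scaleDeficitSplit_rankSum_le s m (v₀ i))⟩
    have hstrict : s * m ^ 3 < r₀ * p' :=
      hS s m p' r₀ hs (le_trans (by norm_num) hm) hp' w₀ u₀ v₀ hdec₀ hrk'
    have hV1R : (V : ℝ) + 1 ≤ (r₀ : ℝ) * (p' : ℝ) := by
      have : V + 1 ≤ r₀ * p' := hstrict
      exact_mod_cast this
    have hp'p : (p' : ℝ) ≤ (p : ℝ) := by exact_mod_cast (min_le_left p (s * m))
    have hp'0 : (0 : ℝ) ≤ (p' : ℝ) := Nat.cast_nonneg _
    -- `V ≤ V₁`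
    have hVV₁ : (V : ℝ) ≤ V₁ := by
      have h1 : s * m ^ 3 ≤ S₀ * b ^ 3 :=
        Nat.mul_le_mul hsS.le (Nat.pow_le_pow_left hmb 3)
      have h2 : ((s * m ^ 3 : ℕ) : ℝ) ≤ ((S₀ * b ^ 3 : ℕ) : ℝ) := by exact_mod_cast h1
      have h3 : ((S₀ * b ^ 3 : ℕ) : ℝ) = (S₀ : ℝ) * (b : ℝ) ^ 3 := by push_cast; ring
      linarith [h2, h3, hV₁def]
    -- `(V+1)³ ≤ r₀³ p'³ ≤ V^{σ+ε} V^θ = V³ V^{θδ+ε}`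
    have hcube : ((V : ℝ) + 1) ^ (3 : ℕ) ≤ (r₀ : ℝ) ^ (3 : ℕ) * (p' : ℝ) ^ (3 : ℕ) := by
      rw [← mul_pow]
      exact pow_le_pow_left₀ (by linarith) hV1R 3
    have hp'3 : (p' : ℝ) ^ (3 : ℕ) ≤ (V : ℝ) ^ θ :=
      le_trans (pow_le_pow_left₀ hp'0 hp'p 3) hscale
    have hup : (r₀ : ℝ) ^ (3 : ℕ) * (p' : ℝ) ^ (3 : ℕ) ≤ (V : ℝ) ^ (σ + ε) * (V : ℝ) ^ θ :=
      mul_le_mul hcost hp'3 (by positivity) (Real.rpow_nonneg hVpos.le _)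
    have hexp : (V : ℝ) ^ (σ + ε) * (V : ℝ) ^ θ
        = (V : ℝ) ^ (3 : ℕ) * (V : ℝ) ^ (θ * δ + ε) := by
      rw [← Real.rpow_add hVpos, ← hV3, ← Real.rpow_add hVpos]
      congr 1
      simp only [hσdef]
      ring
    have hsmall : (V : ℝ) ^ (θ * δ + ε) ≤ 1 + 1 / (2 * V₁) := by
      have h1 : θ * δ + ε ≤ x₁ := by linarith
      calc (V : ℝ) ^ (θ * δ + ε) ≤ (V : ℝ) ^ x₁ :=
            Real.rpow_le_rpow_of_exponent_le hVone.le h1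
        _ ≤ V₁ ^ x₁ := Real.rpow_le_rpow hVpos.le hVV₁ hx₁.le
        _ = 1 + 1 / (2 * V₁) := hV₁x
    have hfin : ((V : ℝ) + 1) ^ (3 : ℕ) ≤ (V : ℝ) ^ (3 : ℕ) * (1 + 1 / (2 * V₁)) :=
      calc ((V : ℝ) + 1) ^ (3 : ℕ) ≤ (r₀ : ℝ) ^ (3 : ℕ) * (p' : ℝ) ^ (3 : ℕ) := hcube
        _ ≤ (V : ℝ) ^ (σ + ε) * (V : ℝ) ^ θ := hup
        _ = (V : ℝ) ^ (3 : ℕ) * (V : ℝ) ^ (θ * δ + ε) := hexp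
        _ ≤ (V : ℝ) ^ (3 : ℕ) * (1 + 1 / (2 * V₁)) :=
            mul_le_mul_of_nonneg_left hsmall (by positivity)
    -- but `(V+1)³ ≥ V³ + 3V² > V³ (1 + 1/(2V₁))` because `V ≤ V₁`
    have hkey : (V : ℝ) ^ (3 : ℕ) * (1 / (2 * V₁)) ≤ (V : ℝ) ^ 2 / 2 := by
      have hratio : (V : ℝ) / V₁ ≤ 1 := (div_le_one hV₁pos).mpr hVV₁
      have hrew : (V : ℝ) ^ (3 : ℕ) * (1 / (2 * V₁)) = (V : ℝ) ^ 2 / 2 * ((V : ℝ) / V₁) := by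
        field_simp
      rw [hrew]
      exact mul_le_of_le_one_right (by positivity) hratio
    have hsplit : (V : ℝ) ^ (3 : ℕ) * (1 + 1 / (2 * V₁))
        = (V : ℝ) ^ (3 : ℕ) + (V : ℝ) ^ (3 : ℕ) * (1 / (2 * V₁)) := by ring
    rw [hsplit] at hfin
    have hbin : ((V : ℝ) + 1) ^ (3 : ℕ) = (V : ℝ) ^ (3 : ℕ) + 3 * (V : ℝ) ^ 2 + 3 * (V : ℝ) + 1 := by
      ring
    rw [hbin] at hfin
    have hV2 : (0 : ℝ) ≤ (V : ℝ) ^ 2 := by positivity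
    linarith
  · -- MANY-COPY REGIME (`s ≥ S₀`): amortized strictness (X₃)
    have hAm' := hAm s m p r₀ hsS (le_trans (by norm_num) hm) hmb hp w₀ u₀ v₀ hdec₀ hrk₀
    have hmono : (p : ℝ) ^ (1 - γ) ≤ (p : ℝ) ^ (1 - γ') :=
      Real.rpow_le_rpow_of_exponent_le hp1 (by linarith)
    have hVle : (V : ℝ) ≤ (r₀ : ℝ) * (p : ℝ) ^ (1 - γ') :=
      le_trans hAm' (mul_le_mul_of_nonneg_left hmono hr0)
    have hcube : (V : ℝ) ^ (3 : ℕ) ≤ (r₀ : ℝ) ^ (3 : ℕ) * ((p : ℝ) ^ (3 : ℕ)) ^ (1 - γ') := by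
      have h1 : (V : ℝ) ^ (3 : ℕ) ≤ ((r₀ : ℝ) * (p : ℝ) ^ (1 - γ')) ^ (3 : ℕ) :=
        pow_le_pow_left₀ hVpos.le hVle 3
      have h2 : ((r₀ : ℝ) * (p : ℝ) ^ (1 - γ')) ^ (3 : ℕ)
          = (r₀ : ℝ) ^ (3 : ℕ) * ((p : ℝ) ^ (3 : ℕ)) ^ (1 - γ') := by
        rw [mul_pow]
        congr 1
        rw [← Real.rpow_natCast ((p : ℝ) ^ (1 - γ')) 3, ← Real.rpow_mul hp0,
          ← Real.rpow_natCast (p : ℝ) 3, ← Real.rpow_mul hp0]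
        congr 1
        push_cast
        ring
      exact h1.trans_eq h2
    have hp3 : ((p : ℝ) ^ (3 : ℕ)) ^ (1 - γ') ≤ ((V : ℝ) ^ θ) ^ (1 - γ') :=
      Real.rpow_le_rpow (by positivity) hscale (by linarith)
    have hup : (V : ℝ) ^ (3 : ℕ) ≤ (V : ℝ) ^ (σ + ε) * ((V : ℝ) ^ θ) ^ (1 - γ') :=
      hcube.trans (mul_le_mul hcost hp3 (Real.rpow_nonneg (by positivity) _)
        (Real.rpow_nonneg hVpos.le _))
    have hexp : (V : ℝ) ^ (σ + ε) * ((V : ℝ) ^ θ) ^ (1 - γ')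
        = (V : ℝ) ^ (σ + ε + θ * (1 - γ')) := by
      rw [← Real.rpow_mul hVpos.le, ← Real.rpow_add hVpos]
    rw [hexp, ← hV3, Real.rpow_le_rpow_left_iff hVone] at hup
    -- `3 ≤ σ + ε + θ(1−γ')`, i.e. `θγ' ≤ θδ + ε ≤ 3θγ'/4`: contradiction
    have e1 : σ + ε + θ * (1 - γ') = 3 - θ + θ * δ + ε + θ - θ * γ' := by
      simp only [hσdef]
      ring
    rw [e1] at hup
    linarith
/-- The decomposition glue stated BY NAME over the route's decls (items
stmt-MatrixMultiplication-18287 `BoundedBlockExhaustion`, stmt-MatrixMultiplication-6601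
`StrictXRankLaw`, stmt-MatrixMultiplication-18270 `AmortizedBlockStrictness` ⇒
stmt-MatrixMultiplication-6600 `ScaleDeficit`): the three pieces are the route's leaves and
`ScaleDeficit` is derived. [folklore] -/
theorem scaleDeficit_of_pieces :
    BoundedBlockExhaustion → StrictXRankLaw → AmortizedBlockStrictness → ScaleDeficit :=
  fun hE hS hA => scaleDeficit_of_subs hE hS hA

end Summit.MatrixMultiplication.MatrixMultiplication.Theorems
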